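import Summits.HodgeConjecture.HodgeConjecture.Theorems.EndoscopicMiddleDegreeMiddleThetaSpanHeckeIdempotents
import Literature.AlgebraicTopology.SingularHomology.CohomologyRingChangeFunctoriality
import Literature.AlgebraicTopology.SingularHomology.IntegralClassRingChange
import Literature.AlgebraicGeometry.HodgeTheory.RationalClassesRingChange

/-!
# The coefficient-conjugation SIEVE for Hecke pieces of a ball quotient

Clause (1) — the absolute-Hodge-free SIEVE — of the informal crux `ThetaOrthogonalClassification`
(stmt-HodgeConjecture-14613) of route `EndoscopicMiddleDegree`, which is VERBATIM the registered stub
`stub_sieve` of line `conjugate-dimension-sieve` of crux `MiddleThetaSpan` (stmt-HodgeConjecture-13661,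
skeleton `Cruxes/MiddleThetaSpan/Lines/conjugate-dimension-sieve.lean`) and step 2 of the route proof of
crux `OrthogonalEnveloped` (stmt-HodgeConjecture-14300). Vocabulary (`HeckeDatum`, `heckeAlgebra`,
`IsPrimitiveCentralIdempotent`, `conjAct`, `IsConjugate`, `primitivePart`) from its home
`Theorems/EndoscopicMiddleDegreeMiddleThetaSpanHeckeIdempotents.lean`.

WHAT IS PROVED (`stub_sieve`, signature byte-identical with the registered stub). For `m ∈ {1,2}`, a
datum `D` on `X` and `H = H²ⁿ(X(ℂ); ℂ)`, `n = m + 1`: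
(∃) for every `σ ∈ Aut(ℂ)` and every primitive central idempotent `e` of the Hecke algebra
`𝓗 = heckeAlgebra D (2n) ⊆ End_ℂ H` there is a conjugate `e^σ` (`σ_* ∘ e = e^σ ∘ σ_*`) which is again
a primitive central idempotent of `𝓗` — namely `e^σ = σ_* ∘ e ∘ σ_*⁻¹` (`conjEnd σ e`);
(a) SUPPORT: for `σ`-conjugate endomorphisms `e, e'` and a RATIONAL class `c`, `e c = 0 ↔ e' c = 0`;
(b) DIMENSION: for `σ`-conjugate `e, e'` and a rational `ℓ ∈ H²`, `dim_ℂ e(P_ℓ) = dim_ℂ e'(P_ℓ)`,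
`P_ℓ = ker(· ∪ ℓ)` the primitive part.

HOW. `σ_* = conjAct X σ k` is the change of coefficients along `σ` (tree:
`singularCohomology.ringChange`): it FIXES rational classes (`conjAct_eq_self_of_isRationalClass`:
`σ_* ∘ ι = (σ ∘ ι)_* = ι_*`, `ι : ℚ ↪ ℂ`, by functoriality `ringChange_comp_apply` and
`isRationalClass_iff_exists_ringChange`), commutes with pull-backs (`singularCohomology.ringChange_map`)
and with the transfer of a finite regular cover (`ringChange_transferMap`), hence with every classical
Hecke operator `T = τ ∘ q^*` (`conjAct_op`), so `conjEnd σ T = T` and the `σ`-semilinear ring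
automorphism `conjEnd σ` of `End_ℂ H` maps `𝓗 = Algebra.adjoin ℂ {T}` into itself
(`conjEnd_mem_heckeAlgebra`, `Algebra.adjoin_induction`), central idempotents to central idempotents and
primitive ones to primitive ones (`isCentralIdempotent_conjEnd`, `isPrimitiveCentralIdempotent_conjEnd`;
inverse `conjEnd σ⁻¹`). (a): `e' c = e' (σ_* c) = σ_* (e c)` and `σ_*` is injective. (b): a conjugate
`e'` of `e` IS `conjEnd σ e` (`σ_*` is onto), `P_ℓ` is `σ_*^{±1}`-stable (`σ_*(x ∪ ℓ) = σ_* x ∪ ℓ`,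
`ringChange_cupProduct`), and `finrank_map_conjEnd` (a `σ`-semilinear bijection preserves `finrank`).
Mathematics: Hatcher, Algebraic Topology (2002) §3.1 p. 198 (change of coefficients), §3.G p. 321
(transfer); BMM arXiv:1306.1515 Part 2 §1.9 (`σ`-conjugates of Hecke-isotypic pieces). No named facts.

ORBITS (appended for line `conjugate-dimension-sieve`, `--supports stmt-HodgeConjecture-13661`). Conjugacy
under `Aut(ℂ)` is a groupoid on endomorphisms of `H` — reflexive along `1` (`IsConjugate.refl'`,
`ringChange_id_apply`), symmetric along `σ ↦ σ⁻¹` (`IsConjugate.symm'`), transitive along composition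
(`IsConjugate.trans'`, `ringChange_comp_apply`) — and EVERY conjugate of a primitive central idempotent
of `𝓗` is one (`IsConjugate.isPrimitiveCentralIdempotent`: it is `conjEnd σ e`). Hence the line's
trichotomy of Hecke pieces is constant on `Aut(ℂ)`-orbits: `IsTateType.of_isConjugate`,
`IsKilledType.of_isConjugate`, `IsCoreType.of_isConjugate` — the Tate-type / killed / core pieces are
the orbits `{e^σ}_σ`, i.e. the `ℚ`-Hecke-isotypic pieces `N` (`N ⊗ ℂ = ⊕_σ M[σπ_f]`) of the card.
-/

noncomputable section

namespace Summit.HodgeConjecture.HodgeConjecture.Cruxes.MiddleThetaSpan.ConjugateDimensionSieve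

open scoped BigOperators
open Literature.AlgebraicGeometry.Motives (SchemeOver ComplexPoints)
open Literature.AlgebraicGeometry.HodgeTheory
open Literature.AlgebraicGeometry.ShimuraVarieties
open Literature.AlgebraicTopology.SingularHomology
open Summit.HodgeConjecture.HodgeConjecture.Theses.EndoscopicMiddleDegree

-- The crux-workfile namespace `Summit.<P>.<Sub>.Cruxes.…` repeats `HodgeConjecture` (single-conjunct summit).
set_option linter.dupNamespace false

variable {p : ℕ} {X : SchemeOver ℂ}

/-! ## `σ_*` fixes rational classes and commutes with the Hecke operators -/

/-- **`σ_*` fixes rational classes**: for `σ ∈ Aut(ℂ)` and a rational class `c = ι_* x`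
(`ι : ℚ ↪ ℂ`), `σ_* c = (σ ∘ ι)_* x = ι_* x = c`, since `σ ∘ ι = ι` (a ring homomorphism out of `ℚ`
is unique). [cite: HatcherAT2002, §3.1 p. 198] -/
theorem conjAct_eq_self_of_isRationalClass (σ : ℂ ≃+* ℂ) (k : ℕ) {c : complexBetti X k}
    (hc : IsRationalClass c) : conjAct X σ k c = c := by
  obtain ⟨x, rfl⟩ := (isRationalClass_iff_exists_ringChange c).1 hc
  change singularCohomology.ringChange (σ : ℂ →+* ℂ) (ComplexPoints X) k
      (singularCohomology.ringChange (algebraMap ℚ ℂ) (ComplexPoints X) k x) = _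
  rw [← ringChange_comp_apply, Subsingleton.elim ((σ : ℂ →+* ℂ).comp (algebraMap ℚ ℂ)) (algebraMap ℚ ℂ)]

/-- **`σ_*` commutes with every classical Hecke operator** `T_Δ = τ ∘ q^*` of a Hecke datum: the
change of coefficients acts on the VALUES of cochains, pull-back and transfer on the simplices
(`singularCohomology.ringChange_map`, `ringChange_transferMap`). [cite: HatcherAT2002, §3.G p. 321] -/
theorem conjAct_op {D : UnitaryBallQuotientDatum p X} {g : GL (Fin (p + 1)) D.E} (Δ : HeckeDatum D g)
    (σ : ℂ ≃+* ℂ) (k : ℕ) (x : complexBetti X k) :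
    conjAct X σ k (Δ.op k x) = Δ.op k (conjAct X σ k x) := by
  change singularCohomology.ringChange (σ : ℂ →+* ℂ) (ComplexPoints X) k
      (Δ.cov.transferMap (R := ℂ) k (singularCohomology.map ℂ ℂ Δ.q k x)) =
    Δ.cov.transferMap (R := ℂ) k (singularCohomology.map ℂ ℂ Δ.q k
      (singularCohomology.ringChange (σ : ℂ →+* ℂ) (ComplexPoints X) k x))
  rw [ringChange_transferMap, singularCohomology.ringChange_map]

/-- Hence `conjEnd σ T_Δ = σ_* ∘ T_Δ ∘ σ_*⁻¹ = T_Δ`: the Hecke operators are "defined over `ℚ`".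
[cite: BergeronMillsonMoeglin2016Balls, Part 2 §1.9] -/
theorem conjEnd_op {D : UnitaryBallQuotientDatum p X} {g : GL (Fin (p + 1)) D.E} (Δ : HeckeDatum D g)
    (σ : ℂ ≃+* ℂ) (k : ℕ) : conjEnd σ (Δ.op k) = Δ.op k := by
  refine LinearMap.ext fun x => ?_
  rw [conjEnd_apply]
  change conjAct X σ k (Δ.op k _) = _
  rw [conjAct_op]
  exact congrArg (Δ.op k) (ringChange_symm_apply σ x)

/-! ## `conjEnd σ` preserves the Hecke algebra and its (primitive) central idempotents -/

/-- **`conjEnd σ` maps the Hecke algebra into itself**: it is additive, multiplicative, sends scalars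
`r • 1` to `σ(r) • 1` and fixes the generators `T_Δ`, so it preserves `Algebra.adjoin ℂ {T_Δ}`
(induction on the adjunction). [cite: BergeronMillsonMoeglin2016Balls, Part 2 §1.9] -/
theorem conjEnd_mem_heckeAlgebra (D : UnitaryBallQuotientDatum p X) (σ : ℂ ≃+* ℂ) (k : ℕ)
    {a : Module.End ℂ (complexBetti X k)} (ha : a ∈ heckeAlgebra D k) :
    conjEnd σ a ∈ heckeAlgebra D k := by
  induction ha using Algebra.adjoin_induction with
  | mem T hT =>
    obtain ⟨g, Δ, rfl⟩ := hT
    rw [conjEnd_op]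
    exact Algebra.subset_adjoin ⟨g, Δ, rfl⟩
  | algebraMap r =>
    rw [conjEnd_algebraMap]
    exact Subalgebra.algebraMap_mem _ _
  | add a b _ _ iha ihb =>
    rw [conjEnd_add]
    exact Subalgebra.add_mem _ iha ihb
  | mul a b _ _ iha ihb =>
    rw [conjEnd_mul]
    exact Subalgebra.mul_mem _ iha ihb

/-- **`conjEnd σ` preserves central idempotents of the Hecke algebra** (it is a ring endomorphism of
`End_ℂ H` preserving `𝓗`, with inverse `conjEnd σ⁻¹` also preserving `𝓗`).
[cite: BergeronMillsonMoeglin2016Balls, Part 2 §1.9] -/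
theorem isCentralIdempotent_conjEnd {D : UnitaryBallQuotientDatum p X} {k : ℕ} (σ : ℂ ≃+* ℂ)
    {e : Module.End ℂ (complexBetti X k)} (he : IsCentralIdempotent (heckeAlgebra D k) e) :
    IsCentralIdempotent (heckeAlgebra D k) (conjEnd σ e) := by
  obtain ⟨heA, hee, hcomm⟩ := he
  refine ⟨conjEnd_mem_heckeAlgebra D σ k heA, ?_, fun a ha => ?_⟩
  · rw [← conjEnd_mul, hee]
  · have hb : conjEnd σ.symm a ∈ heckeAlgebra D k := conjEnd_mem_heckeAlgebra D σ.symm k ha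
    conv_lhs => rw [← conjEnd_conjEnd_symm σ a]
    conv_rhs => rw [← conjEnd_conjEnd_symm σ a]
    rw [← conjEnd_mul, ← conjEnd_mul, hcomm _ hb]

/-- **`conjEnd σ` preserves PRIMITIVE central idempotents of the Hecke algebra**: non-vanishing and
primitivity transport along the mutually inverse ring endomorphisms `conjEnd σ`, `conjEnd σ⁻¹`.
[cite: BergeronMillsonMoeglin2016Balls, Part 2 §1.9] -/
theorem isPrimitiveCentralIdempotent_conjEnd {D : UnitaryBallQuotientDatum p X} {k : ℕ} (σ : ℂ ≃+* ℂ)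
    {e : Module.End ℂ (complexBetti X k)} (he : IsPrimitiveCentralIdempotent (heckeAlgebra D k) e) :
    IsPrimitiveCentralIdempotent (heckeAlgebra D k) (conjEnd σ e) := by
  obtain ⟨hce, hne, hprim⟩ := he
  refine ⟨isCentralIdempotent_conjEnd σ hce, fun h0 => hne ?_, fun f hf => ?_⟩
  · rw [← conjEnd_symm_conjEnd σ e, h0, conjEnd_zero]
  · have hg : IsCentralIdempotent (heckeAlgebra D k) (conjEnd σ.symm f) := isCentralIdempotent_conjEnd σ.symm hf
    rcases hprim _ hg with h | h
    · left
      rw [← conjEnd_conjEnd_symm σ f, ← conjEnd_mul, h, conjEnd_zero]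
    · right
      rw [← conjEnd_conjEnd_symm σ f, ← conjEnd_mul, h]

/-! ## Conjugates: existence and uniqueness -/

/-- `conjEnd σ e` is a `σ`-conjugate of `e`: `σ_* (e x) = (conjEnd σ e) (σ_* x)`. [folklore] -/
theorem isConjugate_conjEnd (σ : ℂ ≃+* ℂ) (k : ℕ) (e : Module.End ℂ (complexBetti X k)) :
    IsConjugate X k σ e (conjEnd σ e) :=
  fun x => (conjEnd_apply_ringChange σ e x).symm

/-- A `σ`-conjugate of `e` IS `conjEnd σ e` (`σ_*` is onto, with section `σ⁻¹_*`). [folklore] -/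
theorem IsConjugate.eq_conjEnd {σ : ℂ ≃+* ℂ} {k : ℕ} {e e' : Module.End ℂ (complexBetti X k)}
    (h : IsConjugate X k σ e e') : e' = conjEnd σ e := by
  refine LinearMap.ext fun x => ?_
  rw [conjEnd_apply]
  have hx := h (singularCohomology.ringChange (σ.symm : ℂ →+* ℂ) (ComplexPoints X) k x)
  change singularCohomology.ringChange (σ : ℂ →+* ℂ) (ComplexPoints X) k _ =
    e' (singularCohomology.ringChange (σ : ℂ →+* ℂ) (ComplexPoints X) k _) at hx
  rw [ringChange_symm_apply] at hx
  exact hx.symm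

/-! ## (a) Support and (b) dimension -/

/-- **(a) SUPPORT.** For `σ`-conjugate `e, e'` and a rational class `c`: `e c = 0 ↔ e' c = 0`
(`e' c = e' (σ_* c) = σ_* (e c)`, and `σ_*` is injective). [cite: BergeronMillsonMoeglin2016Balls, Part 2 §1.9] -/
theorem IsConjugate.apply_eq_zero_iff {σ : ℂ ≃+* ℂ} {k : ℕ} {e e' : Module.End ℂ (complexBetti X k)}
    (h : IsConjugate X k σ e e') {c : complexBetti X k} (hc : IsRationalClass c) :
    e c = 0 ↔ e' c = 0 := by
  have key : e' c = conjAct X σ k (e c) := by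
    rw [h c, conjAct_eq_self_of_isRationalClass σ k hc]
  rw [key]
  refine ⟨fun h0 => by rw [h0, map_zero], fun h0 => ringChange_equiv_injective σ ?_⟩
  rw [map_zero]
  exact h0

/-- The primitive part `P_ℓ = ker(· ∪ ℓ)` of a RATIONAL `ℓ` is stable under `σ_*`:
`σ_* x ∪ ℓ = σ_* x ∪ σ_* ℓ = σ_*(x ∪ ℓ)`. [cite: HatcherAT2002, §3.2 p. 215] -/
theorem conjAct_mem_primitivePart (σ : ℂ ≃+* ℂ) (m : ℕ) {ℓ : complexBetti X (2 * 1)}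
    (hℓ : IsRationalClass ℓ) {x : complexBetti X (2 * (m + 1))} (hx : x ∈ primitivePart ℓ m) :
    conjAct X σ (2 * (m + 1)) x ∈ primitivePart ℓ m := by
  simp only [primitivePart, LinearMap.mem_ker, LinearMap.flip_apply] at hx ⊢
  have hℓ' := conjAct_eq_self_of_isRationalClass σ (2 * 1) hℓ
  change singularCohomology.ringChange (σ : ℂ →+* ℂ) (ComplexPoints X) (2 * 1) ℓ = ℓ at hℓ'
  change cupProduct _ (singularCohomology.ringChange (σ : ℂ →+* ℂ) (ComplexPoints X) (2 * (m + 1)) x) ℓ = 0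
  conv_lhs => rw [← hℓ']
  rw [← singularCohomology.ringChange_cupProduct, hx, map_zero]

/-- **(b) DIMENSION.** For `σ`-conjugate `e, e'` and a rational `ℓ`: `dim_ℂ e(P_ℓ) = dim_ℂ e'(P_ℓ)`
(`e' = conjEnd σ e`; `σ_*` restricts to a `σ`-semilinear bijection `e(P_ℓ) ≃ e'(P_ℓ)`, which preserves
`finrank` — `finrank_map_conjEnd`). [cite: BergeronMillsonMoeglin2016Balls, Part 2 §1.9] -/
theorem IsConjugate.finrank_map_primitivePart_eq {σ : ℂ ≃+* ℂ} (m : ℕ)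
    {e e' : Module.End ℂ (complexBetti X (2 * (m + 1)))} (h : IsConjugate X (2 * (m + 1)) σ e e')
    {ℓ : complexBetti X (2 * 1)} (hℓ : IsRationalClass ℓ) :
    Module.finrank ℂ ↥((primitivePart ℓ m).map e) = Module.finrank ℂ ↥((primitivePart ℓ m).map e') := by
  rw [h.eq_conjEnd]
  exact finrank_map_conjEnd σ (primitivePart ℓ m)
    (fun x hx => conjAct_mem_primitivePart σ m hℓ hx)
    (fun x hx => conjAct_mem_primitivePart σ.symm m hℓ hx) e

/-! ## The registered stub (signature BYTE-IDENTICAL with `Lines/conjugate-dimension-sieve.lean`) -/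

/-- **Stub 3 — THE SIEVE (clause (1) of `ThetaOrthogonalClassification`; the absolute-Hodge-free lever
of line `conjugate-dimension-sieve` and of the route proof of `OrthogonalEnveloped`).** For
`m ∈ {1,2}` and a datum `D`, on `H = H²ⁿ(X(ℂ); ℂ)`:
(∃) every primitive central idempotent `e` of the Hecke algebra has, for every `σ ∈ Aut(ℂ)`, a conjugate
`e^σ` (`σ_* ∘ e = e^σ ∘ σ_*`) which is again a primitive central idempotent of the Hecke algebra;
(a) SUPPORT: for conjugate endomorphisms `e, e'` and a RATIONAL class `c`, `e c = 0 ↔ e' c = 0`;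
(b) DIMENSION: for conjugate `e, e'` and rational `ℓ`, `dim_ℂ e(P_ℓ) = dim_ℂ e'(P_ℓ)`.
Consequence used downstream (the sieve proper): a rational class has zero component in every Hecke
piece some conjugate of which kills it — rationality is consumed exactly once, through COEFFICIENT
conjugation of Betti cohomology (`σ` acts on `Hᵏ(X(ℂ); ℚ) ⊗ ℂ` through `ℂ`), never through conjugation
of the variety: no absolute-Hodge input. The bounds on `m` are not used.
[cite: BergeronMillsonMoeglin2016Balls, Part 2 §1.9] [cite: HatcherAT2002, §3.1 p. 198] -/
theorem stub_sieve :
    ∀ (m : ℕ) (X : SchemeOver ℂ) (D : UnitaryBallQuotientDatum (2 * (m + 1)) X), 1 ≤ m → m ≤ 2 →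
      (∀ (σ : ℂ ≃+* ℂ) (e : Module.End ℂ (complexBetti X (2 * (m + 1)))),
          IsPrimitiveCentralIdempotent (heckeAlgebra D (2 * (m + 1))) e →
            ∃ e' : Module.End ℂ (complexBetti X (2 * (m + 1))),
              IsPrimitiveCentralIdempotent (heckeAlgebra D (2 * (m + 1))) e' ∧
                IsConjugate X (2 * (m + 1)) σ e e') ∧
      (∀ (σ : ℂ ≃+* ℂ) (e e' : Module.End ℂ (complexBetti X (2 * (m + 1)))),
          IsConjugate X (2 * (m + 1)) σ e e' →
            (∀ c : complexBetti X (2 * (m + 1)), IsRationalClass c → (e c = 0 ↔ e' c = 0)) ∧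
            (∀ ℓ : complexBetti X (2 * 1), IsRationalClass ℓ →
              Module.finrank ℂ ↥((primitivePart ℓ m).map e) =
                Module.finrank ℂ ↥((primitivePart ℓ m).map e'))) := by
  intro m X D _ _
  refine ⟨fun σ e he => ⟨conjEnd σ e, isPrimitiveCentralIdempotent_conjEnd σ he, isConjugate_conjEnd σ _ e⟩, fun σ e e' h => ⟨?_, ?_⟩⟩
  · exact fun c hc => h.apply_eq_zero_iff hc
  · exact fun ℓ hℓ => h.finrank_map_primitivePart_eq m hℓ

/-! ## The sieve proper: killed pieces carry no component of a rational `(n,n)`-class -/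

/-- **THE SIEVE PROPER (clause (1) of `ThetaOrthogonalClassification`, sentence form).** Granted that
the Hecke algebra preserves the Hodge type `(n,n)` (hypothesis `hH`; in print: Hecke correspondences are
algebraic, BMM arXiv:1306.1515 Thm 61 — the registered `stub_heckeHodgeType`, open in the tree), a
RATIONAL primitive class `c` of type `(n,n)` has ZERO component `e c = 0` in every Hecke piece `e` of
KILLED type, i.e. in every piece which — or some `Aut(ℂ)`-conjugate of which — carries no non-zero
`(n,n)`-class: if the conjugate `e'` kills `(n,n)`-classes then `e' c = 0` (`e' c ∈ e'(P)` is of type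
`(n,n)` by `hH`), hence `e c = 0` by (a) of `stub_sieve`. Rationality enters only through the
coefficient conjugation `σ_*`; no absolute-Hodge hypothesis. So a rational Hodge `(n,n)`-class has
components only in Tate-type pieces and cores (`IsCoreType := ¬ IsTateType ∧ ¬ IsKilledType`).
[cite: BergeronMillsonMoeglin2016Balls, Part 2 §1.9] -/
theorem apply_eq_zero_of_isKilledType {m : ℕ} {X : SchemeOver ℂ}
    (D : UnitaryBallQuotientDatum (2 * (m + 1)) X) (ℓ : complexBetti X (2 * 1))
    (hH : ∀ a ∈ heckeAlgebra D (2 * (m + 1)), ∀ c : complexBetti X (2 * (m + 1)),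
      IsOfHodgeType (2 * (m + 1)) X (2 * (m + 1)) (m + 1) (m + 1) c →
        IsOfHodgeType (2 * (m + 1)) X (2 * (m + 1)) (m + 1) (m + 1) (a c))
    {e : Module.End ℂ (complexBetti X (2 * (m + 1)))} (he : e ∈ heckeAlgebra D (2 * (m + 1)))
    (hK : IsKilledType D ℓ m e) {c : complexBetti X (2 * (m + 1))} (hcP : c ∈ primitivePart ℓ m)
    (hcQ : IsRationalClass c) (hcH : IsOfHodgeType (2 * (m + 1)) X (2 * (m + 1)) (m + 1) (m + 1) c) :
    e c = 0 := by
  rcases hK with hk | ⟨σ, e', he', hconj, hk⟩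
  · exact hk _ (Submodule.mem_map_of_mem hcP) (hH e he c hcH)
  · exact (hconj.apply_eq_zero_iff hcQ).2 (hk _ (Submodule.mem_map_of_mem hcP) (hH e' he'.1.1 c hcH))

/-- **Dichotomy of the Hecke pieces meeting a rational Hodge class (clause (1), last sentence: "the pieces
left are TATE-TYPE or CORES").** Granted Hodge-type stability of the Hecke algebra (`hH`, as above), a
Hecke piece `e` carrying a non-zero component `e c ≠ 0` of some RATIONAL primitive `(n,n)`-class `c` is of
Tate type or a core — it cannot be of killed type (`apply_eq_zero_of_isKilledType`); the trichotomy
Tate / killed / core is exhaustive by definition of `IsCoreType`. [cite: BergeronMillsonMoeglin2016Balls, Part 2 §1.9] -/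
theorem isTateType_or_isCoreType_of_apply_ne_zero {m : ℕ} {X : SchemeOver ℂ}
    (D : UnitaryBallQuotientDatum (2 * (m + 1)) X) (ℓ : complexBetti X (2 * 1))
    (hH : ∀ a ∈ heckeAlgebra D (2 * (m + 1)), ∀ c : complexBetti X (2 * (m + 1)),
      IsOfHodgeType (2 * (m + 1)) X (2 * (m + 1)) (m + 1) (m + 1) c →
        IsOfHodgeType (2 * (m + 1)) X (2 * (m + 1)) (m + 1) (m + 1) (a c))
    {e : Module.End ℂ (complexBetti X (2 * (m + 1)))} (he : e ∈ heckeAlgebra D (2 * (m + 1)))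
    {c : complexBetti X (2 * (m + 1))} (hcP : c ∈ primitivePart ℓ m) (hcQ : IsRationalClass c)
    (hcH : IsOfHodgeType (2 * (m + 1)) X (2 * (m + 1)) (m + 1) (m + 1) c) (hec : e c ≠ 0) :
    IsTateType D ℓ m e ∨ IsCoreType D ℓ m e := by
  by_cases hT : IsTateType D ℓ m e
  · exact Or.inl hT
  · refine Or.inr ⟨hT, fun hK => hec ?_⟩
    exact apply_eq_zero_of_isKilledType D ℓ hH he hK hcP hcQ hcH

/-! ## Conjugacy under `Aut(ℂ)` is a groupoid; the trichotomy is constant on `Aut(ℂ)`-orbits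
(line `conjugate-dimension-sieve`, `--supports stmt-HodgeConjecture-13661`) -/

/-- **Reflexivity**: `e` is conjugate to itself along the identity automorphism (`1_* = id`,
`ringChange_id_apply`). [folklore] -/
theorem IsConjugate.refl' (k : ℕ) (e : Module.End ℂ (complexBetti X k)) :
    IsConjugate X k (RingEquiv.refl ℂ) e e := by
  intro x
  have h1 : ((RingEquiv.refl ℂ : ℂ ≃+* ℂ) : ℂ →+* ℂ) = RingHom.id ℂ := RingHom.ext fun _ => rfl
  change singularCohomology.ringChange ((RingEquiv.refl ℂ : ℂ ≃+* ℂ) : ℂ →+* ℂ) (ComplexPoints X) k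
      (e x) =
    e (singularCohomology.ringChange ((RingEquiv.refl ℂ : ℂ ≃+* ℂ) : ℂ →+* ℂ) (ComplexPoints X) k x)
  rw [h1, ringChange_id_apply, ringChange_id_apply]

/-- **Symmetry**: if `e'` is the `σ`-conjugate of `e`, then `e` is the `σ⁻¹`-conjugate of `e'`
(`e' = σ_* ∘ e ∘ σ⁻¹_*`, so `σ⁻¹_* ∘ e' = e ∘ σ⁻¹_*`). [folklore] -/
theorem IsConjugate.symm' {σ : ℂ ≃+* ℂ} {k : ℕ} {e e' : Module.End ℂ (complexBetti X k)}
    (h : IsConjugate X k σ e e') : IsConjugate X k σ.symm e' e := by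
  intro x
  rw [h.eq_conjEnd, conjEnd_apply]
  change singularCohomology.ringChange (σ.symm : ℂ →+* ℂ) (ComplexPoints X) k
      (singularCohomology.ringChange (σ : ℂ →+* ℂ) (ComplexPoints X) k
        (e (singularCohomology.ringChange (σ.symm : ℂ →+* ℂ) (ComplexPoints X) k x))) =
    e (singularCohomology.ringChange (σ.symm : ℂ →+* ℂ) (ComplexPoints X) k x)
  rw [ringChange_apply_symm]

/-- **Transitivity**: a `σ`-conjugation followed by a `τ`-conjugation is a `(τ ∘ σ)`-conjugation
(`(τ ∘ σ)_* = τ_* ∘ σ_*`, `ringChange_comp_apply`; Mathlib's `σ.trans τ` is `τ ∘ σ`). [folklore] -/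
theorem IsConjugate.trans' {σ τ : ℂ ≃+* ℂ} {k : ℕ} {e e' e'' : Module.End ℂ (complexBetti X k)}
    (h : IsConjugate X k σ e e') (h' : IsConjugate X k τ e' e'') :
    IsConjugate X k (σ.trans τ) e e'' := by
  intro x
  have hστ : ((σ.trans τ : ℂ ≃+* ℂ) : ℂ →+* ℂ) = (τ : ℂ →+* ℂ).comp (σ : ℂ →+* ℂ) :=
    RingHom.ext fun _ => rfl
  change singularCohomology.ringChange ((σ.trans τ : ℂ ≃+* ℂ) : ℂ →+* ℂ) (ComplexPoints X) k (e x) =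
    e'' (singularCohomology.ringChange ((σ.trans τ : ℂ ≃+* ℂ) : ℂ →+* ℂ) (ComplexPoints X) k x)
  rw [hστ, ringChange_comp_apply, ringChange_comp_apply]
  change conjAct X τ k (conjAct X σ k (e x)) = e'' (conjAct X τ k (conjAct X σ k x))
  rw [h x, h' (conjAct X σ k x)]

/-- **Every `σ`-conjugate of a primitive central idempotent of the Hecke algebra is one** (not only the
chosen `conjEnd σ e` of `stub_sieve` (∃): a conjugate IS `conjEnd σ e`, `IsConjugate.eq_conjEnd`). So
the hypothesis `IsPrimitiveCentralIdempotent … e'` next to `IsConjugate … e e'` in `IsTateType` /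
`IsKilledType` is automatic for a primitive `e`. [cite: BergeronMillsonMoeglin2016Balls, Part 2 §1.9] -/
theorem IsConjugate.isPrimitiveCentralIdempotent {D : UnitaryBallQuotientDatum p X} {σ : ℂ ≃+* ℂ}
    {k : ℕ} {e e' : Module.End ℂ (complexBetti X k)} (h : IsConjugate X k σ e e')
    (he : IsPrimitiveCentralIdempotent (heckeAlgebra D k) e) :
    IsPrimitiveCentralIdempotent (heckeAlgebra D k) e' := by
  rw [h.eq_conjEnd]
  exact isPrimitiveCentralIdempotent_conjEnd σ he

/-- **Tate type is constant on `Aut(ℂ)`-orbits** of primitive central idempotents: if `e` is of Tate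
type and `e'` is a `σ`-conjugate of `e`, then `e'` is of Tate type (the piece of `e'` is the `σ`-conjugate
piece of `e`; a `τ`-conjugate of `e'` is a `(τ ∘ σ)`-conjugate of `e`). The Tate-type pieces of the card
are thus `Aut(ℂ)`-orbits `{e^σ}_σ`, i.e. `ℚ`-Hecke-isotypic pieces.
[cite: BergeronMillsonMoeglin2016Balls, Part 2 §1.9] -/
theorem IsTateType.of_isConjugate {D : UnitaryBallQuotientDatum p X} {ℓ : complexBetti X (2 * 1)}
    {m : ℕ} {σ : ℂ ≃+* ℂ} {e e' : Module.End ℂ (complexBetti X (2 * (m + 1)))}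
    (hT : IsTateType D ℓ m e) (he : IsPrimitiveCentralIdempotent (heckeAlgebra D (2 * (m + 1))) e)
    (h : IsConjugate X (2 * (m + 1)) σ e e') : IsTateType D ℓ m e' :=
  ⟨hT.2 σ e' (h.isPrimitiveCentralIdempotent he) h,
    fun τ e'' he'' h' => hT.2 (σ.trans τ) e'' he'' (h.trans' h')⟩

/-- **Killed type is constant on `Aut(ℂ)`-orbits** of primitive central idempotents: if `e` is killed
(its piece, or the piece of some `τ`-conjugate `e''`, carries no non-zero `(n,n)`-class) and `e'` is a
`σ`-conjugate of `e`, then `e'` is killed — witnessed by the `σ⁻¹`-conjugate `e` of `e'`, resp. by the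
`(τ ∘ σ⁻¹)`-conjugate `e''`. [cite: BergeronMillsonMoeglin2016Balls, Part 2 §1.9] -/
theorem IsKilledType.of_isConjugate {D : UnitaryBallQuotientDatum p X} {ℓ : complexBetti X (2 * 1)}
    {m : ℕ} {σ : ℂ ≃+* ℂ} {e e' : Module.End ℂ (complexBetti X (2 * (m + 1)))}
    (hK : IsKilledType D ℓ m e) (he : IsPrimitiveCentralIdempotent (heckeAlgebra D (2 * (m + 1))) e)
    (h : IsConjugate X (2 * (m + 1)) σ e e') : IsKilledType D ℓ m e' := by
  rcases hK with hk | ⟨τ, e'', he'', hconj, hk⟩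
  · exact Or.inr ⟨σ.symm, e, he, h.symm', hk⟩
  · exact Or.inr ⟨σ.symm.trans τ, e'', he'', h.symm'.trans' hconj, hk⟩

/-- **Core type is constant on `Aut(ℂ)`-orbits** of primitive central idempotents (`IsCoreType :=
¬ IsTateType ∧ ¬ IsKilledType`, and both are orbit-invariant; transport back along `σ⁻¹`). With
`stub_sieve` (b) all pieces of a core orbit have the same dimension on the primitive part.
[cite: BergeronMillsonMoeglin2016Balls, Part 2 §1.9] -/
theorem IsCoreType.of_isConjugate {D : UnitaryBallQuotientDatum p X} {ℓ : complexBetti X (2 * 1)}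
    {m : ℕ} {σ : ℂ ≃+* ℂ} {e e' : Module.End ℂ (complexBetti X (2 * (m + 1)))}
    (hC : IsCoreType D ℓ m e) (he : IsPrimitiveCentralIdempotent (heckeAlgebra D (2 * (m + 1))) e)
    (h : IsConjugate X (2 * (m + 1)) σ e e') : IsCoreType D ℓ m e' :=
  have he' : IsPrimitiveCentralIdempotent (heckeAlgebra D (2 * (m + 1))) e' :=
    h.isPrimitiveCentralIdempotent he
  ⟨fun hT => hC.1 (hT.of_isConjugate he' h.symm'), fun hK => hC.2 (hK.of_isConjugate he' h.symm')⟩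

end Summit.HodgeConjecture.HodgeConjecture.Cruxes.MiddleThetaSpan.ConjugateDimensionSieve

end
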